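import Literature.RepresentationTheory.Semisimple.CharpolySubquotient
import Mathlib.LinearAlgebra.Trace
import Mathlib.LinearAlgebra.Complex.FiniteDimensional
import Mathlib.LinearAlgebra.Dimension.OrzechProperty
import Mathlib.Data.Complex.BigOperators
import HarnessLib

/-!
# Trace lemmas for the Popa–Zagier trace computation on M-symbols

Elementary linear algebra used to evaluate `tr(T_n | S₂(Γ₀(N)))` through the permutation module
`ℚ^{SL₂(ℤ)/Γ₀(N)}` (Popa 2018, §2 "The proof"): additivity of the trace along a short exact
sequence (from the tree's `LinearMap.charpoly_eq_mul_of_exact`), the "swap lemma"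
`tr(f | A + B) = tr(f | A ∩ B)` for `f(A) ⊆ B`, `f(B) ⊆ A` (Popa–Zagier 2017, proof of Lemma 5 /
Popa 2018 §2: "for any linear operator `T` on `A + B` such that `TA ⊂ B` and `TB ⊂ A`, one has
`tr(T, A ∩ B) = tr(T, A + B)`"), the comparison of the `ℚ`-trace on a full-rank `ℚ`-form with the
real trace, and `tr_ℝ = 2 Re tr_ℂ` for a complex-linear map.

## References
* [Popa2014] A. Popa, *On the trace formula for Hecke operators on congruence subgroups, II*,
  Res. Math. Sci. 5 (2018), §2.
* [PopaZagier2017] A. Popa, D. Zagier, *A combinatorial refinement of the Kronecker–Hurwitz class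
  number relation*, Proc. Amer. Math. Soc. 145 (2017), proof of Lemma 5.
-/

noncomputable section

namespace Literature.NumberTheory.EllipticCurves.ModularForms

namespace HeckeTraceLinearAlgebra

open Module LinearMap
open Literature.RepresentationTheory.Semisimple

variable {k : Type*} [Field k] {V : Type*} [AddCommGroup V] [Module k V] [FiniteDimensional k V]

/-- `tr f = −nextCoeff (charpoly f)` (Mathlib's `Matrix.trace_eq_neg_charpoly_nextCoeff` in a
basis). [folklore] -/
theorem trace_eq_neg_nextCoeff_charpoly {W : Type*} [AddCommGroup W] [Module k W]
    [FiniteDimensional k W] (g : W →ₗ[k] W) : LinearMap.trace k W g = -g.charpoly.nextCoeff := by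
  classical
  rw [LinearMap.trace_eq_matrix_trace k (Module.finBasis k _) g, Matrix.trace_eq_neg_charpoly_nextCoeff,
    LinearMap.charpoly_toMatrix]

/-- **Additivity of the trace along a short exact sequence** `0 → S' → V → Q' → 0` with compatible
endomorphisms: `tr f = tr f_S + tr f_Q` (Bourbaki, *Algèbre* VIII §20 n°6; via
`LinearMap.charpoly_eq_mul_of_exact`). [folklore] -/
theorem trace_eq_add_of_exact {S' : Type*} {Q' : Type*} [AddCommGroup S'] [Module k S']
    [FiniteDimensional k S'] [AddCommGroup Q'] [Module k Q'] [FiniteDimensional k Q']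
    (f : V →ₗ[k] V) (i : S' →ₗ[k] V) (π : V →ₗ[k] Q') (hi : Function.Injective i)
    (hπ : Function.Surjective π) (hex : LinearMap.range i = LinearMap.ker π)
    (fS : S' →ₗ[k] S') (fQ : Q' →ₗ[k] Q') (hS : i ∘ₗ fS = f ∘ₗ i) (hQ : π ∘ₗ f = fQ ∘ₗ π) :
    LinearMap.trace k V f = LinearMap.trace k S' fS + LinearMap.trace k Q' fQ := by
  rw [trace_eq_neg_nextCoeff_charpoly f, trace_eq_neg_nextCoeff_charpoly fS,
    trace_eq_neg_nextCoeff_charpoly fQ, LinearMap.charpoly_eq_mul_of_exact f i π hi hπ hex fS fQ hS hQ,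
    Polynomial.Monic.nextCoeff_mul (LinearMap.charpoly_monic _) (LinearMap.charpoly_monic _), neg_add]

/-- **Trace along an invariant kernel and a surjection**: if `φ : V ↠ Y` is surjective and
`φ ∘ f = g ∘ φ`, then `tr f = tr (f | ker φ) + tr g`. [folklore] -/
theorem trace_eq_trace_restrict_ker_add {Y : Type*} [AddCommGroup Y] [Module k Y]
    [FiniteDimensional k Y] (f : V →ₗ[k] V) (φ : V →ₗ[k] Y) (hφ : Function.Surjective φ)
    (g : Y →ₗ[k] Y) (hcomm : φ ∘ₗ f = g ∘ₗ φ) :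
    LinearMap.trace k V f =
      LinearMap.trace k (LinearMap.ker φ) (f.restrict (p := LinearMap.ker φ) (q := LinearMap.ker φ)
        fun x hx => by
          rw [LinearMap.mem_ker] at hx ⊢
          have := congrArg (fun h => h x) hcomm
          simp only [LinearMap.coe_comp, Function.comp_apply, hx, map_zero] at this
          exact this) +
        LinearMap.trace k Y g :=
  trace_eq_add_of_exact f (LinearMap.ker φ).subtype φ (Submodule.injective_subtype _) hφ
    (Submodule.range_subtype _) _ g (LinearMap.ext fun _ => rfl) hcomm

/-- **The swap lemma** (Popa–Zagier): if `f(A) ⊆ B` and `f(B) ⊆ A` then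
`tr(f | A + B) = tr(f | A ∩ B)`.  Proof: along `0 → A ∩ B → A × B → A + B → 0`
(`c ↦ (c, -c)`, `(a, b) ↦ a + b`) the endomorphism `(a, b) ↦ (f b, f a)` of `A × B` has trace `0`
(it is off-diagonal) and induces `-f` on `A ∩ B` and `f` on `A + B`. [cite: PopaZagier2017, proof of Lemma 5] -/
theorem trace_restrict_sup_eq_trace_restrict_inf (f : V →ₗ[k] V) (A B : Submodule k V)
    (hA : ∀ a ∈ A, f a ∈ B) (hB : ∀ b ∈ B, f b ∈ A)
    (hsup : ∀ x ∈ A ⊔ B, f x ∈ A ⊔ B) (hinf : ∀ x ∈ A ⊓ B, f x ∈ A ⊓ B) :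
    LinearMap.trace k ↥(A ⊔ B) (f.restrict hsup) = LinearMap.trace k ↥(A ⊓ B) (f.restrict hinf) := by
  classical
  -- the three maps
  let fAB : A →ₗ[k] B := (f ∘ₗ A.subtype).codRestrict B fun a => hA a a.2
  let fBA : B →ₗ[k] A := (f ∘ₗ B.subtype).codRestrict A fun b => hB b b.2
  let F : (A × B) →ₗ[k] (A × B) :=
    (LinearMap.inl k A B ∘ₗ fBA ∘ₗ LinearMap.snd k A B) + (LinearMap.inr k A B ∘ₗ fAB ∘ₗ LinearMap.fst k A B)
  let i : ↥(A ⊓ B) →ₗ[k] (A × B) :=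
    LinearMap.prod (Submodule.inclusion inf_le_left) (-(Submodule.inclusion inf_le_right))
  let π : (A × B) →ₗ[k] ↥(A ⊔ B) :=
    (A.subtype ∘ₗ LinearMap.fst k A B + B.subtype ∘ₗ LinearMap.snd k A B).codRestrict (A ⊔ B)
      fun x => Submodule.add_mem _ (Submodule.mem_sup_left x.1.2) (Submodule.mem_sup_right x.2.2)
  have hi : Function.Injective i := by
    intro x y hxy
    have h1 := congrArg Prod.fst hxy
    simp only [i, LinearMap.prod_apply] at h1
    exact Submodule.inclusion_injective _ h1
  have hπ : Function.Surjective π := by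
    rintro ⟨x, hx⟩
    obtain ⟨a, ha, b, hb, rfl⟩ := Submodule.mem_sup.mp hx
    exact ⟨(⟨a, ha⟩, ⟨b, hb⟩), Subtype.ext rfl⟩
  have hex : LinearMap.range i = LinearMap.ker π := by
    ext ⟨a, b⟩
    simp only [LinearMap.mem_range, LinearMap.mem_ker, i, π]
    constructor
    · rintro ⟨c, hc⟩
      rw [← hc]
      apply Subtype.ext
      simp [LinearMap.codRestrict_apply]
    · intro h
      have h' : (a : V) + b = 0 := congrArg Subtype.val h
      have hbA : (b : V) ∈ A := by
        have : (b : V) = -a := eq_neg_of_add_eq_zero_right h'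
        rw [this]; exact A.neg_mem a.2
      refine ⟨⟨-b, A.neg_mem hbA, B.neg_mem b.2⟩, ?_⟩
      ext
      · simp only [LinearMap.prod_apply]
        have : (a : V) = -b := eq_neg_of_add_eq_zero_left h'
        exact this.symm
      · simp [LinearMap.prod_apply]
  have hS : i ∘ₗ (-(f.restrict hinf)) = F ∘ₗ i := by
    apply LinearMap.ext
    intro c
    ext
    · simp [i, F, fBA, LinearMap.codRestrict_apply, LinearMap.restrict_apply]
    · simp [i, F, fAB, LinearMap.codRestrict_apply, LinearMap.restrict_apply]
  have hQ : π ∘ₗ F = f.restrict hsup ∘ₗ π := by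
    apply LinearMap.ext
    rintro ⟨a, b⟩
    apply Subtype.ext
    simp [π, F, fAB, fBA, LinearMap.codRestrict_apply, LinearMap.restrict_apply, add_comm]
  have htr := trace_eq_add_of_exact F i π hi hπ hex (-(f.restrict hinf)) (f.restrict hsup) hS hQ
  have hF : LinearMap.trace k (A × B) F = 0 := by
    simp only [F, map_add]
    rw [LinearMap.trace_comp_comm', LinearMap.comp_assoc, LinearMap.snd_comp_inl, LinearMap.comp_zero,
      map_zero, LinearMap.trace_comp_comm', LinearMap.comp_assoc, LinearMap.fst_comp_inr,
      LinearMap.comp_zero, map_zero, add_zero]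
  rw [hF, map_neg] at htr
  linear_combination -htr

/-- **A full-rank `ℚ`-form computes the real trace**: if `Y ⊆ W` is a `ℚ`-subspace of the
finite-dimensional real vector space `W` with `dim_ℚ Y = dim_ℝ W` and `ℝ Y = W`, stable under the
real-linear `F`, then `tr_ℚ (F | Y) = tr_ℝ F` (a `ℚ`-basis of `Y` is an `ℝ`-basis of `W`, and the
matrices agree). [folklore] -/
theorem trace_restrict_ratForm_eq {W : Type*} [AddCommGroup W] [Module ℝ W] [FiniteDimensional ℝ W]
    [Module ℚ W] [IsScalarTower ℚ ℝ W] (Y : Submodule ℚ W) [FiniteDimensional ℚ Y]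
    (hrank : Module.finrank ℚ Y = Module.finrank ℝ W)
    (hspan : Submodule.span ℝ (Y : Set W) = ⊤) (F : W →ₗ[ℝ] W) (hF : ∀ y ∈ Y, F y ∈ Y) :
    ((LinearMap.trace ℚ Y ((F.restrictScalars ℚ).restrict hF) : ℚ) : ℝ) = LinearMap.trace ℝ W F := by
  classical
  let b := Module.finBasis ℚ Y
  let v : Fin (Module.finrank ℚ Y) → W := fun i => (b i : W)
  -- coordinates over `ℚ` give coordinates over `ℝ`
  have hcoord : ∀ y : Y, (y : W) = ∑ j, ((b.repr y j : ℚ) : ℝ) • v j := fun y => by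
    conv_lhs => rw [← b.sum_repr y]
    rw [Submodule.coe_sum]
    refine Finset.sum_congr rfl fun j _ => ?_
    rw [Submodule.coe_smul, Rat.cast_smul_eq_qsmul (R := ℝ)]
  have hvspan : ⊤ ≤ Submodule.span ℝ (Set.range v) := by
    rw [← hspan, Submodule.span_le]
    intro y hy
    rw [SetLike.mem_coe, show y = ((⟨y, hy⟩ : Y) : W) from rfl, hcoord ⟨y, hy⟩]
    exact Submodule.sum_mem _ fun j _ => Submodule.smul_mem _ _ (Submodule.subset_span ⟨j, rfl⟩)
  have hli : LinearIndependent ℝ v :=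
    linearIndependent_of_top_le_span_of_card_eq_finrank hvspan (by rw [Fintype.card_fin, hrank])
  let B : Basis (Fin (Module.finrank ℚ Y)) ℝ W := Basis.mk hli hvspan
  have hB : ∀ j, B j = v j := fun j => Basis.mk_apply hli hvspan j
  have hrepr : ∀ y : Y, ∀ i, B.repr (y : W) i = ((b.repr y i : ℚ) : ℝ) := fun y i => by
    have h := hcoord y
    simp_rw [← hB] at h
    rw [h, B.repr_sum_self]
  rw [LinearMap.trace_eq_matrix_trace ℝ B, LinearMap.trace_eq_matrix_trace ℚ b, Matrix.trace, Matrix.trace]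
  push_cast
  refine Finset.sum_congr rfl fun i _ => ?_
  rw [Matrix.diag_apply, Matrix.diag_apply, LinearMap.toMatrix_apply, LinearMap.toMatrix_apply, hB,
    ← hrepr]
  rfl

/-- **Realification doubles the real part of the trace**: for a complex-linear endomorphism `F` of a
finite-dimensional complex vector space, `tr_ℝ F = 2 Re tr_ℂ F` (compute in the real basis
`{b_j, i b_j}`). [folklore] -/
theorem trace_restrictScalars_real_eq {W : Type*} [AddCommGroup W] [Module ℂ W] [FiniteDimensional ℂ W]
    (F : W →ₗ[ℂ] W) :
    LinearMap.trace ℝ W (F.restrictScalars ℝ) = 2 * (LinearMap.trace ℂ W F).re := by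
  classical
  let b := Module.finBasis ℂ W
  let B : Basis (Fin 2 × Fin (Module.finrank ℂ W)) ℝ W := Complex.basisOneI.smulTower b
  rw [LinearMap.trace_eq_matrix_trace ℝ B, LinearMap.trace_eq_matrix_trace ℂ b, Matrix.trace, Matrix.trace,
    Complex.re_sum, Finset.mul_sum, Fintype.sum_prod_type, Fin.sum_univ_two, ← Finset.sum_add_distrib]
  refine Finset.sum_congr rfl fun j _ => ?_
  simp only [Matrix.diag_apply, LinearMap.toMatrix_apply, LinearMap.restrictScalars_apply, B,
    Module.Basis.smulTower_apply, Module.Basis.smulTower_repr, map_smul, Complex.coe_basisOneI,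
    Complex.coe_basisOneI_repr, Matrix.cons_val_zero, Matrix.cons_val_one, one_smul,
    Finsupp.smul_apply, smul_eq_mul, Complex.mul_re, Complex.I_re, Complex.I_im, Complex.mul_im]
  ring

end HeckeTraceLinearAlgebra

end Literature.NumberTheory.EllipticCurves.ModularForms

end
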